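import Summits.QuantumAdvantage.QuantumAdvantage.Theorems.PurityDialLawD
import Summits.QuantumAdvantage.QuantumAdvantage.Theorems.RelativeSmolenskyA

/-! # PurityDialLawE — part 5/13 (mechanical split for landing of `PurityDialLaw`; content verbatim; scopes re-opened with their variables) -/

set_option linter.dupNamespace false
noncomputable section

namespace Summit.QuantumAdvantage.QuantumAdvantage.Theorems.PurityDialLaw
open Classical Finset Summit.QuantumAdvantage.AdviceFreeQNC0
open Literature.Computability.MetaComplexity Literature.Computability.MetaComplexity.Smolensky
open Literature.Computability.Complexity (parityFn)

section Intrinsic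

variable {m : ℕ}

/-- `f` is SYMMETRIC (weight-determined). -/
def WtDetermined : Set ((Fin m → Bool) → Bool) := fun f => ∀ z z' : Fin m → Bool, wt z = wt z' → f z = f z'

/-- the standard point of weight `min k m`: `1^k 0^{m−k}`. -/
def stdPt (m k : ℕ) : Fin m → Bool := fun i => decide (i.val < k)

/-- Purity-dial helper `wt_stdPt` (lens-4 g6 PurityDialLaw v12 twin; see the enclosing section docstring). -/
theorem wt_stdPt (k : ℕ) (hk : k ≤ m) : wt (stdPt m k) = k := by
  unfold wt stdPt
  have : (univ.filter fun i : Fin m => decide (i.val < k) = true) = univ.filter fun i : Fin m => i.val < k :=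
    Finset.filter_congr fun i _ => by rw [decide_eq_true_eq]
  rw [this, Fin.card_filter_val_lt]; omega

/-- block embedding: `y ∈ {0,1}^q` on the first `q` coordinates, then `w` ones, then zeros. -/
def emb (q w m : ℕ) (y : Fin q → Bool) (i : Fin m) : Bool :=
  if h : i.val < q then y ⟨i.val, h⟩ else decide (i.val < q + w)

/-- Purity-dial helper `wt_emb` (lens-4 g6 PurityDialLaw v12 twin; see the enclosing section docstring). -/
theorem wt_emb {q w : ℕ} (hqw : q + w ≤ m) (y : Fin q → Bool) : wt (emb q w m y) = wt y + w := by
  unfold wt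
  have hqm : q ≤ m := by omega
  have hsplit : (univ.filter fun i : Fin m => emb q w m y i = true) =
      ((univ.filter fun k : Fin q => y k = true).map (Fin.castLEEmb hqm)) ∪
        ((univ : Finset (Fin w)).map ⟨fun k => (⟨q + k.val, by omega⟩ : Fin m),
          fun a b h => by simp [Fin.ext_iff] at h; exact Fin.ext h⟩) := by
    ext i
    simp only [mem_filter, mem_univ, true_and, mem_union, mem_map, Function.Embedding.coeFn_mk,
      Fin.castLEEmb_apply]
    unfold emb
    by_cases hi : i.val < q
    · rw [dif_pos hi]
      constructor
      · intro hy; left; exact ⟨⟨i.val, hi⟩, hy, Fin.ext rfl⟩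
      · rintro (⟨k, hk, hki⟩ | ⟨k, hki⟩)
        · have : k = ⟨i.val, hi⟩ := Fin.ext (by subst hki; rfl)
          rw [← this]; exact hk
        · exfalso; rw [← hki] at hi; simp at hi
    · rw [dif_neg hi, decide_eq_true_eq]
      constructor
      · intro hlt; right; exact ⟨⟨i.val - q, by omega⟩, Fin.ext (by simp; omega)⟩
      · rintro (⟨k, hk, hki⟩ | ⟨k, hki⟩)
        · exfalso; rw [← hki] at hi; exact hi (by simp)
        · rw [← hki]; simp
  rw [hsplit, Finset.card_union_of_disjoint, Finset.card_map, Finset.card_map, Finset.card_univ,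
    Fintype.card_fin]
  rw [Finset.disjoint_left]
  rintro i hi1 hi2
  rw [mem_map] at hi1 hi2
  obtain ⟨k, -, rfl⟩ := hi1
  obtain ⟨k', -, hk'⟩ := hi2
  have := congrArg Fin.val hk'
  simp at this
  omega

/-- the coordinates of the block embedding have degree `≤ 1`. -/
theorem emb_coord_mem_lowDeg (p : ℕ) [Fact p.Prime] (q w m : ℕ) (i : Fin m) :
    (fun y : Fin q → Bool => if emb q w m y i = true then (1 : ZMod p) else 0) ∈ lowDeg (ZMod p) q 1 := by
  unfold emb
  by_cases hi : i.val < q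
  · have : (fun y : Fin q → Bool => if (if h : i.val < q then y ⟨i.val, h⟩ else decide (i.val < q + w)) = true
        then (1 : ZMod p) else 0) = mono (ZMod p) ({⟨i.val, hi⟩} : Finset (Fin q)) := by
      funext y; rw [dif_pos hi, mono_apply]; simp
    rw [this]; exact mono_mem_lowDeg (by simp)
  · by_cases hw : i.val < q + w
    · have : (fun y : Fin q → Bool => if (if h : i.val < q then y ⟨i.val, h⟩ else decide (i.val < q + w)) = true
          then (1 : ZMod p) else 0) = mono (ZMod p) (∅ : Finset (Fin q)) := by
        funext y; rw [dif_neg hi, mono_apply]; simp [hw]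
      rw [this]; exact mono_mem_lowDeg (by simp)
    · have : (fun y : Fin q → Bool => if (if h : i.val < q then y ⟨i.val, h⟩ else decide (i.val < q + w)) = true
          then (1 : ZMod p) else 0) = 0 := by
        funext y; rw [dif_neg hi]; simp [hw]
      rw [this]; exact Submodule.zero_mem _

/-- **periodicity**: a weight-determined `f` of degree `≤ d < q = p^j` takes the same value at weights `w` and
`w + q` (`p` odd). -/
theorem wtDetermined_periodic (p : ℕ) [hp : Fact p.Prime] (hp2 : p ≠ 2) (j : ℕ) {m d : ℕ}
    (hd : d < p ^ j) {f : (Fin m → Bool) → Bool} (hsym : WtDetermined f) (hf : HasDegF p f d)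
    {z z' : Fin m → Bool} (hw : wt z' = wt z + p ^ j) : f z = f z' := by
  set q := p ^ j with hq
  set w := wt z with hwdef
  have hqw : q + w ≤ m := by have := wt_le z'; omega
  -- the restriction `G` of the indicator of `f` to the block
  set F : CubeFn (ZMod p) m := fun x => if f x then 1 else 0 with hF
  have hFmem : F ∈ lowDeg (ZMod p) m d := hf
  have hG : (fun y => F (emb q w m y)) ∈ lowDeg (ZMod p) q d :=
    Smolensky.comp_mem_lowDeg_of_coord (emb q w m) (emb_coord_mem_lowDeg p q w m) hFmem
  have halt := Summit.QuantumAdvantage.QuantumAdvantage.Theorems.PairFreezing.altSum_eq_zero p hd hG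
  -- the value of `f` at weight `w + k`, read off the standard block point
  set φ : ℕ → ZMod p := fun k => F (emb q w m (stdPt q k)) with hφ
  have hval : ∀ y : Fin q → Bool, F (emb q w m y) = φ (wt y) := by
    intro y
    simp only [hφ, hF]
    have : f (emb q w m y) = f (emb q w m (stdPt q (wt y))) :=
      hsym _ _ (by rw [wt_emb hqw, wt_emb hqw, wt_stdPt _ (wt_le y)])
    rw [this]
  -- group the alternating sum by weight
  have hgroup : ∑ y : Fin q → Bool, (if parityFn q y = true then (-1 : ZMod p) else 1) * F (emb q w m y) =
      ∑ k ∈ range (q + 1), ((q.choose k : ℕ) : ZMod p) * ((if k % 2 = 1 then (-1 : ZMod p) else 1) * φ k) := by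
    rw [← Finset.sum_fiberwise_of_maps_to (s := (univ : Finset (Fin q → Bool))) (t := range (q + 1))
      (g := fun y => wt y) (fun y _ => mem_range.2 (Nat.lt_succ_of_le (wt_le y)))]
    refine Finset.sum_congr rfl fun k hk => ?_
    have : ∀ y ∈ (univ : Finset (Fin q → Bool)).filter (fun y => wt y = k),
        (if parityFn q y = true then (-1 : ZMod p) else 1) * F (emb q w m y) =
          (if k % 2 = 1 then (-1 : ZMod p) else 1) * φ k := by
      intro y hy
      rw [mem_filter] at hy
      rw [hval y, hy.2, parityFn_eq_decide_wt, hy.2]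
      by_cases h : k % 2 = 1
      · rw [if_pos h, if_pos (decide_eq_true h)]
      · rw [if_neg h, if_neg (by rw [decide_eq_true_eq]; exact h)]
    rw [Finset.sum_congr rfl this, Finset.sum_const, card_filter_wt_eq, nsmul_eq_mul]
  rw [hgroup] at halt
  -- only `k = 0` and `k = q` survive mod `p`
  have hq1 : 1 ≤ q := Nat.one_le_pow _ _ hp.out.pos
  have hqodd : q % 2 = 1 := by
    rcases hp.out.eq_two_or_odd with h2 | hodd
    · exact absurd h2 hp2
    · rw [hq, Nat.pow_mod, hodd]; simp
  rw [Finset.sum_eq_add_of_mem 0 q (by simp) (by simp) (by omega)] at halt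
  · rw [Nat.choose_zero_right, Nat.choose_self, Nat.cast_one, one_mul, one_mul, if_neg (by norm_num),
      if_pos hqodd, one_mul, neg_one_mul, ← sub_eq_add_neg, sub_eq_zero] at halt
    -- `φ 0 = F z`-value and `φ q = F z'`-value
    have h0 : φ 0 = F z := by
      simp only [hφ, hF]
      rw [hsym _ z (by rw [wt_emb hqw, wt_stdPt _ (by omega)]; omega)]
    have hq' : φ q = F z' := by
      simp only [hφ, hF]
      rw [hsym _ z' (by rw [wt_emb hqw, wt_stdPt _ le_rfl]; omega)]
    rw [h0, hq'] at halt
    simp only [hF] at halt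
    by_cases h1 : f z = true <;> by_cases h2 : f z' = true
    · rw [h1, h2]
    · rw [if_pos h1, if_neg h2] at halt; exact absurd halt one_ne_zero
    · rw [if_neg h1, if_pos h2] at halt; exact absurd halt.symm one_ne_zero
    · rw [Bool.not_eq_true] at h1 h2; rw [h1, h2]
  · intro k hk hne
    rw [mem_range] at hk
    have hdvd : p ∣ q.choose k := by rw [hq]; exact hp.out.dvd_choose_pow hne.1 (by rw [← hq]; exact hne.2)
    rw [(ZMod.natCast_eq_zero_iff _ _).2 hdvd, zero_mul]

/-- **a weight-determined function of degree `≤ d < p^j` is `p^j`-periodic symmetric** (`p` odd). -/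
theorem symFn_of_wtDetermined (p : ℕ) [hp : Fact p.Prime] (hp2 : p ≠ 2) (j : ℕ) {m d : ℕ}
    (hd : d < p ^ j) {f : (Fin m → Bool) → Bool} (hsym : WtDetermined f) (hf : HasDegF p f d) :
    f = symFn (p ^ j) m (fun k => f (stdPt m k)) := by
  set q := p ^ j with hq
  have hq1 : 1 ≤ q := Nat.one_le_pow _ _ hp.out.pos
  suffices h : ∀ w, ∀ z : Fin m → Bool, wt z = w → f z = f (stdPt m (w % q)) by
    funext z; exact h (wt z) z rfl
  intro w
  induction w using Nat.strong_induction_on with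
  | _ w ih =>
    intro z hz
    by_cases hwq : w < q
    · rw [Nat.mod_eq_of_lt hwq]
      exact hsym _ _ (by rw [hz, wt_stdPt _ (by have := wt_le z; omega)])
    · -- step down by one period
      have hwm : w ≤ m := hz ▸ wt_le z
      have hper : f (stdPt m (w - q)) = f z :=
        wtDetermined_periodic p hp2 j hd hsym hf (z := stdPt m (w - q)) (z' := z)
          (by rw [wt_stdPt _ (by omega), hz]; omega)
      rw [← hper, ih (w - q) (by omega) _ (wt_stdPt _ (by omega))]
      congr 2
      conv_rhs => rw [show w = w - q + q by omega]
      rw [Nat.add_mod_right]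

/-- **Theorem (no symmetric counterexample, intrinsic form).** A weight-determined Boolean function of
`𝔽_p`-degree `≤ d < p^j` (`p` odd) on `m ≥ 2p^{2j}(log₂ p^j + 3)` bits is `3`-balanced. -/
theorem relBal_three_of_wtDetermined (p : ℕ) [hp : Fact p.Prime] (hp2 : p ≠ 2) (j : ℕ) {m d : ℕ}
    (hd : d < p ^ j) (hm : 2 * (p ^ j) ^ 2 * (Nat.log 2 (p ^ j) + 3) ≤ m)
    {f : (Fin m → Bool) → Bool} (hsym : WtDetermined f) (hf : HasDegF p f d) : RelBal 3 f := by
  have hqodd : p ^ j % 2 = 1 := by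
    rcases hp.out.eq_two_or_odd with h2 | hodd
    · exact absurd h2 hp2
    · rw [Nat.pow_mod, hodd]; simp
  rw [symFn_of_wtDetermined p hp2 j hd hsym hf]
  exact relBal_three_symFn (Nat.one_le_pow _ _ hp.out.pos) hqodd hm _

end Intrinsic

/-- **NORMAL FORM — intrinsic version (law level).**  If the dialed law fails then at some prime `p ≥ 5`, for every
polynomial scale `(B, A)`, there is an unbalanced mixed level set of degree `d` in the window
`A(d+1)^B ≤ m < (d+1)²4^{d+1}` which is NOT WEIGHT-DETERMINED as soon as `d < p^j` and `2p^{2j}(log₂ p^j + 3) ≤ m`. -/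
theorem normalForm_not_wtDetermined_law (h : ¬ ∀ (p : ℕ) [Fact p.Prime], 5 ≤ p → ∃ B : ℕ, RelSmolLaw p 3 B) :
    ∃ (p : ℕ) (_ : Fact p.Prime), 5 ≤ p ∧ ∀ B A : ℕ, ∃ (m d : ℕ) (f : (Fin m → Bool) → Bool),
      A * (d + 1) ^ B ≤ m ∧ m < (d + 1) ^ 2 * 4 ^ (d + 1) ∧ HasDegF p f d ∧ ¬ RelBal 3 f ∧
      (oddPart f).Nonempty ∧ (evenPart f).Nonempty ∧
      ∀ j : ℕ, d < p ^ j → 2 * (p ^ j) ^ 2 * (Nat.log 2 (p ^ j) + 3) ≤ m → ¬ WtDetermined f := by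
  obtain ⟨p, hP, hp, hall⟩ := normalForm_of_not_relSmolPoly h
  refine ⟨p, hP, hp, fun B A => ?_⟩
  obtain ⟨m, d, f, h1, h2, h3, h4, h5, h6⟩ := hall B A
  exact ⟨m, d, f, h1, h2, h3, h4, h5, h6, fun j hd hm hsym =>
    h4 (relBal_three_of_wtDetermined p (by omega) j hd hm hsym h3)⟩


/-! ### §19 LOCAL THINNESS FORCES BALANCE: `p`-adic cancellation on the fibres of a `(d+1)`-block

The alternating-sum identity of §18 (`Summit.QuantumAdvantage.QuantumAdvantage.Theorems.PairFreezing.altSum_eq_zero`) holds on EVERY sub-cube of dimension `k > d` with the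
outside coordinates frozen: on each such FIBRE the even and odd parts of a degree-`d` level set agree MODULO `p`
(`fibrePart_modEq`).  Three consequences, all PROVED and all free of any dimension threshold:
(a) THIN ⇒ BALANCED: a fibre carrying fewer than `p` points of the level set is EXACTLY parity-balanced
    (`fibrePart_eq_of_thin`); globally `|#even − #odd| ≤` (mass in `p`-HEAVY fibres) (`parts_sub_le_heavy`), so a
    level set at most half of whose mass lies in heavy fibres of one `k`-block is `3`-balanced (`relBal_three_of_thin`);
(b) SMALL DEGREE IS EXACT: each fibre part is `≤ 2^{k-1}` (`fibrePart_le_pow`), so for `p > 2^{k-1}` EVERY fibre is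
    exactly balanced (`fibrePart_eq_of_pow_lt`) and `#odd = #even` on the nose (`parts_eq_of_pow_lt`,
    `relBal_one_of_pow_lt`): for every prime `p > 2^d` the law holds AT RATIO 1 from `m = d + 1` on — the bottom of
    the dial (`d < log₂ p`) is decided exactly, and an unbalanced degree-`d` level set forces `p ≤ 2^d`
    (`prime_le_pow_of_not_relBal`);
(c) ANY BLOCK: degree and parts are invariant under relabelling the coordinates (`hasDegF_permFn`,
    `card_part_permFn`, `relBal_permFn_iff`), so (a)/(b) hold for every `k`-set of coordinates
    (`relBal_three_of_thin_perm`, `parts_eq_of_pow_lt_perm`).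
NORMAL FORM, sharpened (`normalForm_thick`): a minimal counterexample to the law has degree `d ≥ log₂ p` and is
LOCALLY THICK IN EVERY `(d+1)`-BLOCK — more than half of its support sits in fibres with `≥ p` support points, for
every choice of the block.  This is the structure-vs-sparsity split of the residual: the SPARSE/spread case is decided
by `p`-adic counting, the extremisers (residue readers: every fibre of every block is a full weight level `{wt = r}`
of the block, `C(d+1, r)` points) are thick, §17–§18 decide the thick SYMMETRIC case; the thick ASYMMETRIC case of
degree `≥ log₂ p` is exactly what remains. -/


end Summit.QuantumAdvantage.QuantumAdvantage.Theorems.PurityDialLaw
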